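import Mathlib.MeasureTheory.Integral.IntervalIntegral.Basic
import Mathlib.Analysis.SpecialFunctions.Pow.Real
import Mathlib.Analysis.SpecialFunctions.Log.Basic
import HarnessLib

/-!
# Móricz (2013): Tauberian theorems of slow-decrease type for logarithmic summability `(L, 1)`

Topic `Literature/Analysis/Asymptotics` (next to the Karamata Tauberian files). Two NAMED FACTS
(Literature is sorry-free; users take `(h : Moricz2013_corollary3)` etc.), vendored by a grounder
for route `Parity/BatemanHorn/HurwitzTauber`, support item
`Summit.Parity.BatemanHorn.Theses.HurwitzTauber.SchmidtScales` (stmt-Parity-19030): the Tauberian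
step "logarithmic mean value `C` + Schmidt's one-sided slow decrease on the multiplicative scales
`N → N^(1+δ)` ⇒ mean value `C`".

**Source.** F. Móricz, *Necessary and sufficient Tauberian conditions for the logarithmic
summability of functions and sequences*, Studia Math. 219 (2013), no. 2, 109–121,
doi:10.4064/sm219-2-2 (= arXiv:1206.6188; page/formula numbers below are those of the arXiv text,
held as `paper:arxiv-1206.6188`). Verbatim:

* (∗), p. 1: a locally integrable `s : [1, ∞) → ℂ` "is summable `(L, 1)` if there exists some
  `A ∈ ℂ` such that `lim_{t→∞} τ(t) = A`, where `τ(t) := (1/log t) ∫₁ᵗ s(u)/u du`."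
* (2.3), p. 1: "a function `s : [1, ∞) → ℝ` is slowly decreasing with respect to summability
  `(L, 1)` if for every `ε > 0` there exist `t₀ = t₀(ε) > 1` and `λ = λ(ε) > 1` such that
  `s(u) − s(t) ≥ −ε` whenever `t₀ ≤ t < u ≤ t^λ`."
* COROLLARY 1, p. 2: "Suppose a real-valued function `s ∈ L_loc[1, ∞)` is slowly decreasing with
  respect to summability `(L, 1)`. If `s` is summable `(L, 1)` to some `A ∈ ℝ`, then the ordinary
  limit (1.2) [`lim_{t→∞} s(t) = A`] also exists."
* (5.1), p. 4: a sequence `(s_k)` "is said to be logarithmic summable of order 1 …, briefly: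
  summable `(L, 1)`, if there exists some `A` such that `lim_{n→∞} (1/ℓ_n) Σ_{k=1}^n s_k/k = A`,
  where `ℓ_n := Σ_{k=1}^n 1/k ∼ log n`."
* (5.6), p. 4: "`(s_k)` is slowly decreasing with respect to summability `(L, 1)` if for every
  `ε > 0` there exist a natural number `n₀ = n₀(ε)` and a real number `λ = λ(ε) > 1` such that
  `s_k − s_n ≥ −ε` whenever `n₀ ≤ n < k ≤ n^λ`."
* COROLLARY 3, p. 4: "Suppose a sequence `(s_k)` of real numbers is slowly decreasing with respect
  to summability `(L, 1)`. If `(s_k)` is summable `(L, 1)` to some `A ∈ ℝ`, then the ordinary limit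
  (5.3) [`lim s_n = A`] also exists." (Ibid.: "This corollary was earlier proved by Kwee
  [Math. Proc. Camb. Phil. Soc. 63 (1967) 401–405, Lemma 3] in a different way"; the term
  'slow decrease' is R. Schmidt's, Math. Z. 22 (1925) 89–152, for `(C, 1)`.)

**Relation to the route item.** `SchmidtScales` takes `b ≥ 0` with `Σ_{n≤x} b(n) ≤ Bx`, the
logarithmic mean `(Σ_{n≤x} b(n)/n)/log x → C` and the slow decrease (5.6) (with `λ = 1 + δ`) of
`F(N) := N⁻¹ Σ_{n≤N} b(n)`, and concludes `F(x) → C`. It is Corollary 3 for `s_k := F(k)` composed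
with Abel summation: `Σ_{k≤n} b(k)/k = F(n) + Σ_{k<n} F(k)/(k+1)`, and `0 ≤ F ≤ B` makes
`(1/ℓ_n) Σ_{k≤n} F(k)/k` and `(1/log n) Σ_{k≤n} b(k)/k` converge together (`ℓ_n ∼ log n`). So the item
is fact ∘ (Abel summation bookkeeping), not an instantiation; the fact is recorded AS PRINTED.

## Mathlib / tree search

Mathlib has no Tauberian theorem of Schmidt/slow-decrease type (searched `SlowlyDecreasing`,
`Tauberian`, `Cesaro`: nothing relevant). Tree: `lean search SlowlyDecreasing|slowlyDecreasing|
LogToMean|Tauberian --decl` finds only the NEGATIVE transfer results of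
`Literature/Barriers/Parity/LogarithmicAveraging.lean` (`not_logToMeanTransfer_nonneg`: without a
Tauberian condition the log-to-mean transfer fails on Hall's set), local `SlowlyDecreasingAt`
definitions inside a Navier–Stokes crux, and the Hardy–Littlewood–Karamata facts of
`Literature/NumberTheory/LFunctions/{TauberianTheorems,KaramataTauberian}.lean` and
`Literature/Analysis/Asymptotics/KaramataTauberianLaplace*.lean` (Abel/Dirichlet ⇒ log or Cesàro
means under positivity — a different Tauberian theorem). No slow-decrease Tauberian theorem for the
logarithmic method exists in the tree.

## References

* [Moricz2013] F. Móricz, *Necessary and sufficient Tauberian conditions for the logarithmic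
  summability of functions and sequences*, Studia Math. 219 (2013) 109–121,
  doi:10.4064/sm219-2-2, arXiv:1206.6188: (∗), (2.3), Cor. 1 (pp. 1–2); (5.1), (5.6), Cor. 3 (p. 4).
* B. Kwee, *A Tauberian theorem for the logarithmic method of summation*, Math. Proc. Cambridge
  Philos. Soc. 63 (1967) 401–405, Lemma 3 (the sequence case, earlier).
* R. Schmidt, *Über divergente Folgen und lineare Mittelbildungen*, Math. Z. 22 (1925) 89–152
  (slow decrease for `(C, 1)`).
-/

noncomputable section

open Filter MeasureTheory
open scoped Topology

namespace Literature.Analysis.Asymptotics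

/-- NAMED FACT — **Móricz 2013, Corollary 3** (= Kwee 1967, Lemma 3): a real sequence `(s_k)`
that is *slowly decreasing with respect to summability `(L, 1)`* — (5.6): for every `ε > 0` there
are `n₀ ∈ ℕ` and `λ > 1` with `s_k − s_n ≥ −ε` whenever `n₀ ≤ n < k ≤ n^λ` — and *summable
`(L, 1)` to `A`* — (5.1): `(1/ℓ_n) Σ_{k=1}^n s_k/k → A` with `ℓ_n = Σ_{k=1}^n 1/k` — converges:
`s_n → A`. Grounds the Tauberian step of
`Summit.Parity.BatemanHorn.Theses.HurwitzTauber.SchmidtScales` (item = fact ∘ Abel summation, see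
the module docstring). [cite: Moricz2013, Cor. 3 with (5.1), (5.6)] -/
def Moricz2013_corollary3 : Prop :=
  ∀ (s : ℕ → ℝ) (A : ℝ),
    (∀ ε : ℝ, 0 < ε → ∃ (n₀ : ℕ) (l : ℝ), 1 < l ∧
      ∀ n k : ℕ, n₀ ≤ n → n < k → (k : ℝ) ≤ (n : ℝ) ^ l → -ε ≤ s k - s n) →
    Tendsto (fun n : ℕ => (∑ k ∈ Finset.Icc 1 n, s k / k) / ∑ k ∈ Finset.Icc 1 n, (1 : ℝ) / k)
      atTop (𝓝 A) →
    Tendsto s atTop (𝓝 A)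

/-- NAMED FACT — **Móricz 2013, Corollary 1** (the function case): a real-valued `s`, Lebesgue
integrable on every `[1, t]`, that is *slowly decreasing with respect to summability `(L, 1)`* —
(2.3): for every `ε > 0` there are `t₀ > 1` and `λ > 1` with `s(u) − s(t) ≥ −ε` whenever
`t₀ ≤ t < u ≤ t^λ` — and *summable `(L, 1)` to `A`* — (∗): `(1/log t) ∫₁ᵗ s(u)/u du → A` —
converges: `s(t) → A` as `t → ∞`. [cite: Moricz2013, Cor. 1 with (∗), (2.3)] -/
def Moricz2013_corollary1 : Prop :=
  ∀ (s : ℝ → ℝ) (A : ℝ), (∀ t : ℝ, 1 ≤ t → IntervalIntegrable s volume 1 t) →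
    (∀ ε : ℝ, 0 < ε → ∃ (t₀ l : ℝ), 1 < t₀ ∧ 1 < l ∧
      ∀ t u : ℝ, t₀ ≤ t → t < u → u ≤ t ^ l → -ε ≤ s u - s t) →
    Tendsto (fun t : ℝ => (∫ u in (1 : ℝ)..t, s u / u) / Real.log t) atTop (𝓝 A) →
    Tendsto s atTop (𝓝 A)

end Literature.Analysis.Asymptotics

end
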